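import Summits.QuantumFields.QCD.Theses.HeatSlicedQuarks
import Summits.QuantumFields.QCD.Theorems.HeatSlicedQuarksRobustYangMillsHandoverSplit

/-!
# Line `lebowitz-penrose-continuation` — crux `HeatSlicedQuarks.RobustYangMillsHandover` (item stmt-QuantumFields-8892)
# strategist s3 (planner-cstrat-stmt-QuantumFields-8892-s3), 2026-08-17 — an ALTERNATIVE line, additive; the live
# skeleton `Lines/pin_the_infimum.lean` (lead c16) is untouched.

FRAME.  The R1 frame of the landed split glue (p140732,
`Theorems.RobustYangMillsHandover.Split.RobustYangMillsHandover_of_subs : child 1 → child 2 → child 3 → crux`):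
child 1 `HeavyThresholdHandover` and child 2 `GaplessPointOnMassAxis` are the stubs `stub_heavyThresholdHandover`,
`stub_gaplessPointOnMassAxis` (signatures byte-identical with lines `heavy-goldstone-continuation` (s1) and
`glimm-jaffe-continuation` (s2)); child 3 `GappedMassContinuation` is cut, as in s2, into the lattice RATE continuation
3a and the continuum DATA continuation 3b (`stub_anchoredDataContinuation`, byte-identical with s2).

THE NEW LEVER (3a only).  s2 and the live line obtain 3a from a volume-uniform SIGMA-TERM bound (Feynman–Hellmann 8909 +
transfer-matrix dictionary M1/M2/M6, or the Glimm–Jaffe pseudomass envelope).  Here 3a is obtained WITHOUT any mass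
derivative: from LEE–YANG ANALYTICITY of the finite-volume connected correlators in the COMPLEXIFIED flavour-blind offset
(`stub_massAnalyticAtGappedAnchors`: a `k,S,n`-uniform bounded analytic extension to a complex ball of radius `ρ(reg, ε)`
around every honest, rate-`ε` anchor — `∀ ε ∃ ρ ∀ M`, uniform in `M`, content wherever the rate `ε` is attained, never at
the pin) by the PENROSE–LEBOWITZ mechanism "clustering propagates through the Lee–Yang region" (CMP 39 (1974) 165,
Lemma 1 + Corollary: a sequence of non-positive subharmonic functions with `limsup < 0` on an arc has `limsup < 0`
everywhere; here quantitatively, `stub_analyticRateContinuation`, pure complex analysis over Mathlib: rate `ε` known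
pointwise on the real radius `[0, ρ)` forces rate `ε/2` on `[−cρ, 0]`, `c` an absolute constant — harmonic measure of the
slit seen from `−cρ` exceeds `1/2`).  `stub_rateContinuation` is the lattice bookkeeping `S3 → S4 → 3a` (diagonal
extraction over `(k, S, n)`, normalisation by the a-priori bound).  The dead line `lee-yang-mass-handover` placed its
analyticity AT THE PIN with `δ₀ = δ₀(M, ε)` (≡ the chirality clause, `opensBelow_iff_noUniformRateAbovePin`); here the
radius depends on `ε` only and the statement feeds child 3, not `OpensBelow`; its landed atoms (two-constants p124094,
ellipse certificate p124594) are helper material for `stub_analyticRateContinuation` / `stub_rateContinuation`.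

Composition (sorry-free): `anchoredGapContinuation_of` (= S5 S3 S4), `gappedMassContinuation_of` (3a → 3b → child 3,
s2's proof), `RobustYangMillsHandover_of` = the landed split glue on (S1, S2, child 3): concludes the crux BY NAME.
Sorries: exactly the six `stub_*`.
-/

namespace Summit.QuantumFields.QCD.Cruxes.RobustYangMillsHandover.LebowitzPenroseContinuation

open Summit.QuantumFields.QCD.Theses.HeatSlicedQuarks
open Literature.MathematicalPhysics.QuantumFieldTheory
open Filter Topology

/-! ## §1 The six registered stubs -/

/-- **stub_heavyThresholdHandover — child 1, HEAVY-THRESHOLD HANDOVER** (`X₀ → ThresholdQCD`, the pre-re-type crux;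
signature byte-identical with s1/s2 and the landed split glue).  Robust SU(3) Yang–Mills + heavy-quark decoupling; every
round-1 line of the crux is a line for it.  Size: crux. -/
theorem stub_heavyThresholdHandover :
    ContinuumQCDExists → ∀ Nf : ℕ, Nf = 2 ∨ Nf = 3 → ∃ M₀ : ℝ, 0 ≤ M₀ ∧ ∃ reg : Literature.MathematicalPhysics.QuantumFieldTheory.QCDRegularisation Nf, reg.HasMassScaling ∧ ∀ m : Fin Nf → ℝ, (∀ f, M₀ < m f) → ∃ (z shift : Literature.MathematicalPhysics.QuantumFieldTheory.QCDField Nf → ℕ → ℝ) (T : Literature.MathematicalPhysics.QuantumFieldTheory.OSData (Literature.MathematicalPhysics.QuantumFieldTheory.QCDField Nf) 4), Literature.MathematicalPhysics.QuantumFieldTheory.IsQCDAlong (reg.scheme m z shift) T ∧ T.IsNontrivial Literature.MathematicalPhysics.QuantumFieldTheory.QCDField.glue ∧ T.IsNonGaussian Literature.MathematicalPhysics.QuantumFieldTheory.QCDField.glue ∧ (∀ f g : Fin Nf, f ≠ g → T.IsNontrivial (Literature.MathematicalPhysics.QuantumFieldTheory.QCDField.pseudoRe f g)) ∧ ∃ Δ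 > 0, T.HasMassGap Δ ∧ (reg.scheme m z shift).HasLatticeMassGap Δ := by
  sorry

/-- **stub_gaplessPointOnMassAxis — child 2, A GAPLESS POINT ON THE MASS AXIS** of the threshold regularisation
(Goldstone / Vafa–Witten / anomaly matching; signature byte-identical with s1/s2).  Size: crux. -/
theorem stub_gaplessPointOnMassAxis :
    ∀ Nf : ℕ, Nf = 2 ∨ Nf = 3 → ∀ reg : Literature.MathematicalPhysics.QuantumFieldTheory.QCDRegularisation Nf, reg.HasMassScaling → (∃ M₀ : ℝ, ∀ m : Fin Nf → ℝ, (∀ f, M₀ < m f) → ∃ (z shift : Literature.MathematicalPhysics.QuantumFieldTheory.QCDField Nf → ℕ → ℝ) (T : Literature.MathematicalPhysics.QuantumFieldTheory.OSData (Literature.MathematicalPhysics.QuantumFieldTheory.QCDField Nf) 4), Literature.MathematicalPhysics.QuantumFieldTheory.IsQCDAlong (reg.scheme m z shift) T ∧ T.IsNontrivial Literature.MathematicalPhysics.QuantumFieldTheory.QCDField.glue ∧ T.IsNonGaussian Literature.MathematicalPhysics.QuantumFieldTheory.QCDField.glue ∧ (∀ f g : Fin Nf, f ≠ g → T.IsNontrivial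 (Literature.MathematicalPhysics.QuantumFieldTheory.QCDField.pseudoRe f g)) ∧ ∃ Δ > 0, T.HasMassGap Δ ∧ (reg.scheme m z shift).HasLatticeMassGap Δ) → ∃ M : ℝ, ∀ ε : ℝ, 0 < ε → ∃ m : Fin Nf → ℝ, (∀ f, M < m f) ∧ ¬ (reg.scheme m 0 0).HasLatticeMassGap ε := by
  sorry

/-- **stub_massAnalyticAtGappedAnchors — S3, THE BET: Lee–Yang analyticity in the complexified common offset at honest,
rate-`ε` anchors.**  For every `ε > 0` there is `ρ = ρ(reg, ε) > 0` (uniform in the anchor `M`) such that, whenever the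
body holds above `M` and every tuple above `M` has lattice rate `ε`, then at every tuple `m` above `M` and for every pair
of local gauge-invariant observables there is an a-priori constant `C` with: for all large `k`, all tori `2S+1 ≥ 2L_k+1`,
all separations `n ≤ S`, the connected Euclidean-time correlator at the flavour-blind shifted tuples `m + t·𝟙`, `|t| < ρ`,
is the restriction to the real diameter of a function holomorphic on the complex ball `‖t‖ < ρ` and bounded by `C` there
(finite-volume Lee–Yang zero-freeness of `Z_{k,S}` in the complex offset on balls of `k`-uniform radius in RENORMALISED
units + Lieb–Ruelle/Lebowitz–Penrose uniform bounds on the connected functions in the zero-free region).  Physically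
`ρ(ε) ≍ ε²/(2B̄)` (GMOR: rate `ε` forces renormalised distance `≳ ε²/2B̄` from the chiral point, where the ε-regime zeros
sit, Leutwyler–Smilga 1992).  Why it might fail: complex-offset zeros of `Z_{k,S}` pinching a uniformly torus-gapped real
point as `k → ∞` (no ferromagnetic/GHS structure is available for the fermion determinant), or real zeros of `Z_{k,S}`
for `N_f = 3`.  Size: crux (open mathematical physics; the a-priori bound is part of the claim). -/
theorem stub_massAnalyticAtGappedAnchors :
    ∀ Nf : ℕ, Nf = 2 ∨ Nf = 3 → ∀ reg : Literature.MathematicalPhysics.QuantumFieldTheory.QCDRegularisation Nf, reg.HasMassScaling → ∀ ε : ℝ, 0 < ε → ∃ ρ : ℝ, 0 < ρ ∧ ∀ M : ℝ, (∀ m : Fin Nf → ℝ, (∀ f, M < m f) → ∃ (z shift : Literature.MathematicalPhysics.QuantumFieldTheory.QCDField Nf → ℕ → ℝ) (T : Literature.MathematicalPhysics.QuantumFieldTheory.OSData (Literature.MathematicalPhysics.QuantumFieldTheory.QCDField Nf) 4), Literature.MathematicalPhysics.QuantumFieldTheory.IsQCDAlong (reg.scheme m z shift) T ∧ T.IsNontrivial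 Literature.MathematicalPhysics.QuantumFieldTheory.QCDField.glue ∧ T.IsNonGaussian Literature.MathematicalPhysics.QuantumFieldTheory.QCDField.glue ∧ (∀ f g : Fin Nf, f ≠ g → T.IsNontrivial (Literature.MathematicalPhysics.QuantumFieldTheory.QCDField.pseudoRe f g)) ∧ ∃ Δ > 0, T.HasMassGap Δ ∧ (reg.scheme m z shift).HasLatticeMassGap Δ) → (∀ m : Fin Nf → ℝ, (∀ f, M < m f) → (reg.scheme m 0 0).HasLatticeMassGap ε) → ∀ m : Fin Nf → ℝ, (∀ f, M < m f) → ∀ (R R' : ℕ) (A : Literature.MathematicalPhysics.QuantumFieldTheory.QCDLatticeObservable Nf R) (B : Literature.MathematicalPhysics.QuantumFieldTheory.QCDLatticeObservable Nf R'), ∃ C : ℝ, ∀ᶠ k in Filter.atTop, ∀ S : ℕ, reg.L k ≤ S → ∀ n : ℕ, n ≤ S → ∃ F : ℂ → ℂ, DifferentiableOn ℂ F (Metric.ball (0 : ℂ) ρ) ∧ (∀ w ∈ Metric.ball (0 : ℂ) ρ, ‖F w‖ ≤ C) ∧ ∀ t : ℝ, |t| < ρ → F t = Literature.MathematicalPhysics.QuantumFieldTheory.qcdLatticeConnectedCorr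 (reg.β k) (2 * S + 1) (fun fl => (reg.scheme (fun f => m f + t) 0 0).mq fl k) A B n := by
  sorry

/-- **stub_analyticRateContinuation — S4, PENROSE–LEBOWITZ RATE CONTINUATION (pure complex analysis, Mathlib only).**
There is an absolute constant `c > 0` such that: if `F_j` are holomorphic on the ball `‖w‖ < ρ` and bounded by `1` there,
`N_j → +∞`, and at every real `t ∈ [0, ρ)` eventually `‖F_j t‖ ≤ C_t e^{−ε N_j}` (a pointwise rate `ε`, constants NOT
uniform in `t`), then at every real `s ∈ [−cρ, 0]` eventually `‖F_j s‖ ≤ e^{−(ε/2) N_j}`.  Proof sketch (Penrose–Lebowitz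
1974, Lemma 1): `u_j := N_j⁻¹ log ‖F_j‖ ≤ 0` is subharmonic; in the coordinate `ζ = √w` the slit ball becomes a
half-disc whose diameter is the slit `[0, ρ')` seen from both sides and `−δ ↦ i√δ`; harmonic majorisation with truncated
boundary data `max(u_j, −K)` and reverse Fatou give `limsup_j u_j(−δ) ≤ −ε·ω(−δ)`, `ω(−δ) = 1 − (4/π)·arctan √(δ/ρ')`,
which exceeds `0.78` for `δ ≤ ρ'/36` (and equals `1/2` at `δ/ρ' = tan²(π/8)`), so `c = 1/37` works.  Mathlib handles:
`Mathlib.Analysis.Complex.JensenFormula`, `HarmonicOnNhd.circleAverage_poissonKernel_smul`, `Complex.HadamardThreeLines`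
(cf. the landed `LeeYangMassHandover.stub_twoConstants`, p124094).  A uniform-constant version of the hypothesis is NOT
implied by the pointwise one (moving Gaussian bumps `j·e^{−εN_j}·e^{−j²(w−j^{−1/4})²}`, `N_j = 2j²/ε`), which is why the
landed ellipse certificate p124594 is not applied directly.  Size: L. -/
theorem stub_analyticRateContinuation :
    ∃ c : ℝ, 0 < c ∧ ∀ ρ ε : ℝ, 0 < ρ → 0 < ε → ∀ (F : ℕ → ℂ → ℂ) (N : ℕ → ℝ), Filter.Tendsto N Filter.atTop Filter.atTop → (∀ j, DifferentiableOn ℂ (F j) (Metric.ball (0 : ℂ) ρ)) → (∀ j, ∀ w ∈ Metric.ball (0 : ℂ) ρ, ‖F j w‖ ≤ 1) → (∀ t : ℝ, 0 ≤ t → t < ρ → ∃ C : ℝ, ∀ᶠ j in Filter.atTop, ‖F j t‖ ≤ C * Real.exp (-(ε * N j))) → ∀ s : ℝ, -(c * ρ) ≤ s → s ≤ 0 → ∀ᶠ j in Filter.atTop, ‖F j s‖ ≤ Real.exp (-(ε / 2 * N j)) := by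
  sorry

/-- **stub_rateContinuation — S5, 3a FROM S3 + S4 (lattice bookkeeping).**  Given `ε`, take `ρ` from S3 and `c` from S4
and put `δ := c ρ`.  For a target tuple `m'` above `M − δ` use the anchor `m := m' + δ·𝟙` (above `M`); if the rate-`ε/2`
bound failed at `m'` for a pair `(A, B)` with constant `max C 1 · e^{(ε/2) N₀}` for every `N₀`, extract violating triples
`(k_j, S_j, n_j)` with `k_j → ∞`, `N_j := a_{k_j} n_j → ∞`, and apply S4 to `F_j :=` (the S3 extension at
`(k_j, S_j, n_j)`)`/max C 1`, whose pointwise rate `ε` on `[0, ρ)` is the hypothesis `HasLatticeMassGap ε` at the tuples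
`m + t·𝟙` (above `M`) — contradiction at `s = −δ`.  Size: M. -/
theorem stub_rateContinuation :
    (∀ Nf : ℕ, Nf = 2 ∨ Nf = 3 → ∀ reg : Literature.MathematicalPhysics.QuantumFieldTheory.QCDRegularisation Nf, reg.HasMassScaling → ∀ ε : ℝ, 0 < ε → ∃ ρ : ℝ, 0 < ρ ∧ ∀ M : ℝ, (∀ m : Fin Nf → ℝ, (∀ f, M < m f) → ∃ (z shift : Literature.MathematicalPhysics.QuantumFieldTheory.QCDField Nf → ℕ → ℝ) (T : Literature.MathematicalPhysics.QuantumFieldTheory.OSData (Literature.MathematicalPhysics.QuantumFieldTheory.QCDField Nf) 4), Literature.MathematicalPhysics.QuantumFieldTheory.IsQCDAlong (reg.scheme m z shift) T ∧ T.IsNontrivial Literature.MathematicalPhysics.QuantumFieldTheory.QCDField.glue ∧ T.IsNonGaussian Literature.MathematicalPhysics.QuantumFieldTheory.QCDField.glue ∧ (∀ f g : Fin Nf, f ≠ g → T.IsNontrivial (Literature.MathematicalPhysics.QuantumFieldTheory.QCDField.pseudoRe f g)) ∧ ∃ Δ > 0, T.HasMassGap Δ ∧ (reg.scheme m z shift).HasLatticeMassGap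 Δ) → (∀ m : Fin Nf → ℝ, (∀ f, M < m f) → (reg.scheme m 0 0).HasLatticeMassGap ε) → ∀ m : Fin Nf → ℝ, (∀ f, M < m f) → ∀ (R R' : ℕ) (A : Literature.MathematicalPhysics.QuantumFieldTheory.QCDLatticeObservable Nf R) (B : Literature.MathematicalPhysics.QuantumFieldTheory.QCDLatticeObservable Nf R'), ∃ C : ℝ, ∀ᶠ k in Filter.atTop, ∀ S : ℕ, reg.L k ≤ S → ∀ n : ℕ, n ≤ S → ∃ F : ℂ → ℂ, DifferentiableOn ℂ F (Metric.ball (0 : ℂ) ρ) ∧ (∀ w ∈ Metric.ball (0 : ℂ) ρ, ‖F w‖ ≤ C) ∧ ∀ t : ℝ, |t| < ρ → F t = Literature.MathematicalPhysics.QuantumFieldTheory.qcdLatticeConnectedCorr (reg.β k) (2 * S + 1) (fun fl => (reg.scheme (fun f => m f + t) 0 0).mq fl k) A B n) →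
    (∃ c : ℝ, 0 < c ∧ ∀ ρ ε : ℝ, 0 < ρ → 0 < ε → ∀ (F : ℕ → ℂ → ℂ) (N : ℕ → ℝ), Filter.Tendsto N Filter.atTop Filter.atTop → (∀ j, DifferentiableOn ℂ (F j) (Metric.ball (0 : ℂ) ρ)) → (∀ j, ∀ w ∈ Metric.ball (0 : ℂ) ρ, ‖F j w‖ ≤ 1) → (∀ t : ℝ, 0 ≤ t → t < ρ → ∃ C : ℝ, ∀ᶠ j in Filter.atTop, ‖F j t‖ ≤ C * Real.exp (-(ε * N j))) → ∀ s : ℝ, -(c * ρ) ≤ s → s ≤ 0 → ∀ᶠ j in Filter.atTop, ‖F j s‖ ≤ Real.exp (-(ε / 2 * N j))) →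
    ∀ Nf : ℕ, Nf = 2 ∨ Nf = 3 → ∀ reg : Literature.MathematicalPhysics.QuantumFieldTheory.QCDRegularisation Nf, reg.HasMassScaling → ∀ ε : ℝ, 0 < ε → ∃ δ : ℝ, 0 < δ ∧ ∀ M : ℝ, (∀ m : Fin Nf → ℝ, (∀ f, M < m f) → ∃ (z shift : Literature.MathematicalPhysics.QuantumFieldTheory.QCDField Nf → ℕ → ℝ) (T : Literature.MathematicalPhysics.QuantumFieldTheory.OSData (Literature.MathematicalPhysics.QuantumFieldTheory.QCDField Nf) 4), Literature.MathematicalPhysics.QuantumFieldTheory.IsQCDAlong (reg.scheme m z shift) T ∧ T.IsNontrivial Literature.MathematicalPhysics.QuantumFieldTheory.QCDField.glue ∧ T.IsNonGaussian Literature.MathematicalPhysics.QuantumFieldTheory.QCDField.glue ∧ (∀ f g : Fin Nf, f ≠ g → T.IsNontrivial (Literature.MathematicalPhysics.QuantumFieldTheory.QCDField.pseudoRe f g)) ∧ ∃ Δ > 0, T.HasMassGap Δ ∧ (reg.scheme m z shift).HasLatticeMassGap Δ) → (∀ m : Fin Nf → ℝ, (∀ f, M < m f) → (reg.scheme m 0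 0).HasLatticeMassGap ε) → ∀ m : Fin Nf → ℝ, (∀ f, M - δ < m f) → (reg.scheme m 0 0).HasLatticeMassGap (ε / 2) := by
  sorry

/-- **stub_anchoredDataContinuation — 3b, CONTINUUM DATA CONTINUATION from a uniformly lattice-gapped anchor**
(signature byte-identical with s2's `GlimmJaffeContinuation.stub_anchoredDataContinuation`): `∀ ε ∀ δ ∃ δ' ≤ δ ∀ M`, body
above `M` ∧ lattice rate `ε/2` above `M − δ` ⇒ body above `M − δ'`.  Mechanism foreseen here: Vitali/Montel on the
anchor-renormalised smeared Schwinger functions (analytic in the complexified offset by S3-type zero-freeness, locally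
bounded by the uniform lattice gap + OS positivity), identity theorem for the OS relations along the full sequence,
continuum gap `ε/2` by `transfer_cluster` (p152624); non-triviality persistence on the collar is the open sub-debt.
Size: crux (the generic existence-extension debt of `X₀ → QCD`). -/
theorem stub_anchoredDataContinuation :
    ∀ Nf : ℕ, Nf = 2 ∨ Nf = 3 → ∀ reg : Literature.MathematicalPhysics.QuantumFieldTheory.QCDRegularisation Nf, reg.HasMassScaling → ∀ ε : ℝ, 0 < ε → ∀ δ : ℝ, 0 < δ → ∃ δ' : ℝ, 0 < δ' ∧ δ' ≤ δ ∧ ∀ M : ℝ, (∀ m : Fin Nf → ℝ, (∀ f, M < m f) → ∃ (z shift : Literature.MathematicalPhysics.QuantumFieldTheory.QCDField Nf → ℕ → ℝ) (T : Literature.MathematicalPhysics.QuantumFieldTheory.OSData (Literature.MathematicalPhysics.QuantumFieldTheory.QCDField Nf) 4), Literature.MathematicalPhysics.QuantumFieldTheory.IsQCDAlong (reg.scheme m z shift) T ∧ T.IsNontrivial Literature.MathematicalPhysics.QuantumFieldTheory.QCDField.glue ∧ T.IsNonGaussian Literature.MathematicalPhysics.QuantumFieldTheory.QCDField.glue ∧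 (∀ f g : Fin Nf, f ≠ g → T.IsNontrivial (Literature.MathematicalPhysics.QuantumFieldTheory.QCDField.pseudoRe f g)) ∧ ∃ Δ > 0, T.HasMassGap Δ ∧ (reg.scheme m z shift).HasLatticeMassGap Δ) → (∀ m : Fin Nf → ℝ, (∀ f, M - δ < m f) → (reg.scheme m 0 0).HasLatticeMassGap (ε / 2)) → ∀ m : Fin Nf → ℝ, (∀ f, M - δ' < m f) → ∃ (z shift : Literature.MathematicalPhysics.QuantumFieldTheory.QCDField Nf → ℕ → ℝ) (T : Literature.MathematicalPhysics.QuantumFieldTheory.OSData (Literature.MathematicalPhysics.QuantumFieldTheory.QCDField Nf) 4), Literature.MathematicalPhysics.QuantumFieldTheory.IsQCDAlong (reg.scheme m z shift) T ∧ T.IsNontrivial Literature.MathematicalPhysics.QuantumFieldTheory.QCDField.glue ∧ T.IsNonGaussian Literature.MathematicalPhysics.QuantumFieldTheory.QCDField.glue ∧ (∀ f g : Fin Nf, f ≠ g → T.IsNontrivial (Literature.MathematicalPhysics.QuantumFieldTheory.QCDField.pseudoRe f g)) ∧ ∃ Δ > 0, T.HasMassGap Δ ∧ (reg.scheme m z shift).HasLatticeMassGap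 Δ := by
  sorry

/-! ## §2 3a and child 3 (sorry-free compositions) -/

/-- **3a** (s2's `stub_anchoredGapContinuation` statement, byte-identical) from S3, S4, S5. -/
theorem anchoredGapContinuation_of :
    ∀ Nf : ℕ, Nf = 2 ∨ Nf = 3 → ∀ reg : Literature.MathematicalPhysics.QuantumFieldTheory.QCDRegularisation Nf, reg.HasMassScaling → ∀ ε : ℝ, 0 < ε → ∃ δ : ℝ, 0 < δ ∧ ∀ M : ℝ, (∀ m : Fin Nf → ℝ, (∀ f, M < m f) → ∃ (z shift : Literature.MathematicalPhysics.QuantumFieldTheory.QCDField Nf → ℕ → ℝ) (T : Literature.MathematicalPhysics.QuantumFieldTheory.OSData (Literature.MathematicalPhysics.QuantumFieldTheory.QCDField Nf) 4), Literature.MathematicalPhysics.QuantumFieldTheory.IsQCDAlong (reg.scheme m z shift) T ∧ T.IsNontrivial Literature.MathematicalPhysics.QuantumFieldTheory.QCDField.glue ∧ T.IsNonGaussian Literature.MathematicalPhysics.QuantumFieldTheory.QCDField.glue ∧ (∀ f g : Fin Nf, f ≠ g → T.IsNontrivial (Literature.MathematicalPhysics.QuantumFieldTheory.QCDField.pseudoRe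 f g)) ∧ ∃ Δ > 0, T.HasMassGap Δ ∧ (reg.scheme m z shift).HasLatticeMassGap Δ) → (∀ m : Fin Nf → ℝ, (∀ f, M < m f) → (reg.scheme m 0 0).HasLatticeMassGap ε) → ∀ m : Fin Nf → ℝ, (∀ f, M - δ < m f) → (reg.scheme m 0 0).HasLatticeMassGap (ε / 2) :=
  stub_rateContinuation stub_massAnalyticAtGappedAnchors stub_analyticRateContinuation

/-- **`GappedMassContinuation` (s1's child 3, byte-identical) from 3a + 3b** (s2's six-line proof). [folklore] -/
theorem gappedMassContinuation_of
    (h3a : ∀ Nf : ℕ, Nf = 2 ∨ Nf = 3 → ∀ reg : Literature.MathematicalPhysics.QuantumFieldTheory.QCDRegularisation Nf, reg.HasMassScaling → ∀ ε : ℝ, 0 < ε → ∃ δ : ℝ, 0 < δ ∧ ∀ M : ℝ, (∀ m : Fin Nf → ℝ, (∀ f, M < m f) → ∃ (z shift : Literature.MathematicalPhysics.QuantumFieldTheory.QCDField Nf → ℕ → ℝ) (T : Literature.MathematicalPhysics.QuantumFieldTheory.OSData (Literature.MathematicalPhysics.QuantumFieldTheory.QCDField Nf) 4), Literature.MathematicalPhysics.QuantumFieldTheory.IsQCDAlong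 (reg.scheme m z shift) T ∧ T.IsNontrivial Literature.MathematicalPhysics.QuantumFieldTheory.QCDField.glue ∧ T.IsNonGaussian Literature.MathematicalPhysics.QuantumFieldTheory.QCDField.glue ∧ (∀ f g : Fin Nf, f ≠ g → T.IsNontrivial (Literature.MathematicalPhysics.QuantumFieldTheory.QCDField.pseudoRe f g)) ∧ ∃ Δ > 0, T.HasMassGap Δ ∧ (reg.scheme m z shift).HasLatticeMassGap Δ) → (∀ m : Fin Nf → ℝ, (∀ f, M < m f) → (reg.scheme m 0 0).HasLatticeMassGap ε) → ∀ m : Fin Nf → ℝ, (∀ f, M - δ < m f) → (reg.scheme m 0 0).HasLatticeMassGap (ε / 2))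
    (h3b : ∀ Nf : ℕ, Nf = 2 ∨ Nf = 3 → ∀ reg : Literature.MathematicalPhysics.QuantumFieldTheory.QCDRegularisation Nf, reg.HasMassScaling → ∀ ε : ℝ, 0 < ε → ∀ δ : ℝ, 0 < δ → ∃ δ' : ℝ, 0 < δ' ∧ δ' ≤ δ ∧ ∀ M : ℝ, (∀ m : Fin Nf → ℝ, (∀ f, M < m f) → ∃ (z shift : Literature.MathematicalPhysics.QuantumFieldTheory.QCDField Nf → ℕ → ℝ) (T : Literature.MathematicalPhysics.QuantumFieldTheory.OSData (Literature.MathematicalPhysics.QuantumFieldTheory.QCDField Nf) 4), Literature.MathematicalPhysics.QuantumFieldTheory.IsQCDAlong (reg.scheme m z shift) T ∧ T.IsNontrivial Literature.MathematicalPhysics.QuantumFieldTheory.QCDField.glue ∧ T.IsNonGaussian Literature.MathematicalPhysics.QuantumFieldTheory.QCDField.glue ∧ (∀ f g : Fin Nf, f ≠ g → T.IsNontrivial (Literature.MathematicalPhysics.QuantumFieldTheory.QCDField.pseudoRe f g)) ∧ ∃ Δ > 0, T.HasMassGap Δ ∧ (reg.scheme m z shift).HasLatticeMassGap Δ) → (∀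 m : Fin Nf → ℝ, (∀ f, M - δ < m f) → (reg.scheme m 0 0).HasLatticeMassGap (ε / 2)) → ∀ m : Fin Nf → ℝ, (∀ f, M - δ' < m f) → ∃ (z shift : Literature.MathematicalPhysics.QuantumFieldTheory.QCDField Nf → ℕ → ℝ) (T : Literature.MathematicalPhysics.QuantumFieldTheory.OSData (Literature.MathematicalPhysics.QuantumFieldTheory.QCDField Nf) 4), Literature.MathematicalPhysics.QuantumFieldTheory.IsQCDAlong (reg.scheme m z shift) T ∧ T.IsNontrivial Literature.MathematicalPhysics.QuantumFieldTheory.QCDField.glue ∧ T.IsNonGaussian Literature.MathematicalPhysics.QuantumFieldTheory.QCDField.glue ∧ (∀ f g : Fin Nf, f ≠ g → T.IsNontrivial (Literature.MathematicalPhysics.QuantumFieldTheory.QCDField.pseudoRe f g)) ∧ ∃ Δ > 0, T.HasMassGap Δ ∧ (reg.scheme m z shift).HasLatticeMassGap Δ) :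
    ∀ Nf : ℕ, Nf = 2 ∨ Nf = 3 → ∀ reg : Literature.MathematicalPhysics.QuantumFieldTheory.QCDRegularisation Nf, reg.HasMassScaling → ∀ ε : ℝ, 0 < ε → ∃ δ : ℝ, 0 < δ ∧ ∀ M : ℝ, (∀ m : Fin Nf → ℝ, (∀ f, M < m f) → (reg.scheme m 0 0).HasLatticeMassGap ε) → (∀ m : Fin Nf → ℝ, (∀ f, M < m f) → ∃ (z shift : Literature.MathematicalPhysics.QuantumFieldTheory.QCDField Nf → ℕ → ℝ) (T : Literature.MathematicalPhysics.QuantumFieldTheory.OSData (Literature.MathematicalPhysics.QuantumFieldTheory.QCDField Nf) 4), Literature.MathematicalPhysics.QuantumFieldTheory.IsQCDAlong (reg.scheme m z shift) T ∧ T.IsNontrivial Literature.MathematicalPhysics.QuantumFieldTheory.QCDField.glue ∧ T.IsNonGaussian Literature.MathematicalPhysics.QuantumFieldTheory.QCDField.glue ∧ (∀ f g : Fin Nf, f ≠ g → T.IsNontrivial (Literature.MathematicalPhysics.QuantumFieldTheory.QCDField.pseudoRe f g)) ∧ ∃ Δ > 0, T.HasMassGap Δ ∧ (reg.scheme m z shift).HasLatticeMassGap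 Δ) → ∀ m : Fin Nf → ℝ, (∀ f, M - δ < m f) → ∃ (z shift : Literature.MathematicalPhysics.QuantumFieldTheory.QCDField Nf → ℕ → ℝ) (T : Literature.MathematicalPhysics.QuantumFieldTheory.OSData (Literature.MathematicalPhysics.QuantumFieldTheory.QCDField Nf) 4), Literature.MathematicalPhysics.QuantumFieldTheory.IsQCDAlong (reg.scheme m z shift) T ∧ T.IsNontrivial Literature.MathematicalPhysics.QuantumFieldTheory.QCDField.glue ∧ T.IsNonGaussian Literature.MathematicalPhysics.QuantumFieldTheory.QCDField.glue ∧ (∀ f g : Fin Nf, f ≠ g → T.IsNontrivial (Literature.MathematicalPhysics.QuantumFieldTheory.QCDField.pseudoRe f g)) ∧ ∃ Δ > 0, T.HasMassGap Δ ∧ (reg.scheme m z shift).HasLatticeMassGap Δ := by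
  intro Nf hNf reg hMS ε hε
  obtain ⟨δ₁, hδ₁, h1⟩ := h3a Nf hNf reg hMS ε hε
  obtain ⟨δ', hδ', -, h2⟩ := h3b Nf hNf reg hMS ε hε δ₁ hδ₁
  refine ⟨δ', hδ', fun M hU hB m hm => ?_⟩
  exact h2 M hB (h1 M hB hU) m hm

/-! ## §3 The crux BY NAME (through the landed split glue p140732) -/

/-- **The crux from the six stubs**: child 3 by §2, then
`Theorems.RobustYangMillsHandover.Split.RobustYangMillsHandover_of_subs`.  Sorries only inside `stub_*`. -/
theorem RobustYangMillsHandover_of : Summit.QuantumFields.QCD.Theses.HeatSlicedQuarks.RobustYangMillsHandover :=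
  Summit.QuantumFields.QCD.Theorems.RobustYangMillsHandover.Split.RobustYangMillsHandover_of_subs
    stub_heavyThresholdHandover stub_gaplessPointOnMassAxis
    (gappedMassContinuation_of anchoredGapContinuation_of stub_anchoredDataContinuation)

end Summit.QuantumFields.QCD.Cruxes.RobustYangMillsHandover.LebowitzPenroseContinuation
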